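import Summits.BirchSwinnertonDyer.BirchSwinnertonDyer.Theorems.GenusKolyvaginAtTwoTorsionCellD0Assembly
import HarnessLib

/-!
# D0≤2: the closer — LINE 49's one-step genus Selmer law from the full base setting

Crux R″ `RankOneTwoTorsionResidualAtTwo` (stmt-27478), LINE 49 «full_vertex» (pen bsd-idea-1, hosted at
`Cruxes/MinimalTwinBSDTwo/Lines/torsion_cell_full_vertex_bsdidea1.lean`), stub D0≤2
`FullTorsionGenusSelmerLawUpToTwoAtTwo`:

> for a base `E₀` in a FULL BASE SETTING (`HasFullRationalTwoTorsion E₀`, `Ш(E₀)[2] = 0`, an optimal odd datum,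
> `p₀ ≡ 7 (mod 8)` with every `ℓ ∣ 2N₀` split in `ℚ(√−p₀)`, a finite set `Q₀` of full-admissible primes `≠ p₀`
> with `M₀ = ∏_{q ∈ Q₀} q* > 0` and every `ℓ ∣ 2N₀` split in `ℚ(√M₀)`), `rank E₀(ℚ) = 0` and `#Q₀ ≤ 2`, every
> genus pair `(C₀, C₁)` — `C₀` a model `T • E₀^{(M₀)}`, `C₁` a model `T • E₀^{(−p₀M₀)}` — is SELMER-GENERIC:
> `#C₀(ℚ)[2] = #C₁(ℚ)[2] = 4`, `#Sel⁽²⁾(C₀/ℚ) = 4`, `#Sel⁽²⁾(C₁/ℚ) = 8`.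

This file assembles the statement from the landed kernel counts of the lineage
(`natCard_selmerGroup_negPrime_twist_eq_eight_of_base`, `natCard_selmerGroup_pair_twists_eq_of_base` in
`…D0Assembly`; `natCard_torsionBy_two_smul_quadraticTwist` in `…D0BaseGlue`; the explicit Klagsbrun–Mazur–Rubin
parity half in `…D0TripleTwistOdd`) plus four pieces of bookkeeping:

* `#Q₀ = 0`: `M₀ = 1`, `C₀ ≅ E₀^{(1)} ≅ E₀` (`exists_variableChange_quadraticTwist_one`), so `#Sel⁽²⁾(C₀) = #Sel⁽²⁾(E₀) = 4`
  (`natCard_selmerGroup_two_eq_four`: rank `0`, `Ш[2] = 0`, split `2`-torsion); `C₁ ≅ E₀^{(−p₀)}`.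
* `#Q₀ = 1` is VACUOUS: a full-admissible prime at a full vertex is `≡ 3 (mod 4)`
  (`emod_four_eq_three_of_fullAdmissible`), so `M₀ = q* = −q < 0`, contradicting `M₀ > 0`.
* `#Q₀ = 2`: `M₀ = q₁* q₂* = q₁q₂` and the counts are `natCard_selmerGroup_pair_twists_eq_of_base`.
* transport to the models `T • E₀^{(d)}`: `#Sel⁽ⁿ⁾` and `#E(ℚ)[2]` are isomorphism invariants
  (`natCard_selmerGroup_smul`, `natCard_torsionBy_two_smul_quadraticTwist`).

Main theorem: **`selmerGenericPair_of_fullTorsionBase`**.  The corollary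
**`fullTorsionGenusSelmerLawUpToTwoAtTwo_unfolded`** is LINE 49's `FullTorsionGenusSelmerLawUpToTwoAtTwo` with the
line's own `def`s (`FullBaseSetting`, `HasFullRationalTwoTorsion`, `ShaTwoTrivial`, `IsFullAdmissible`, `IsGenusPair`,
`IsSelmerGenericPair` — they live in the Cruxes workfile and are not importable here) UNFOLDED verbatim, so that the
stub closes by `exact` in the hosted skeleton.  Everything is proved (no named-fact hypothesis); no LINE 49 statement is
re-declared; the crux R″ and BSD are NOT advanced by this file alone (D0≤2 is one support stub of an unregistered line).

## References

* [SilvermanAEC2009] J. H. Silverman, *The Arithmetic of Elliptic Curves*, 2nd ed., GTM 106, Prop. X.1.4, Thm. X.4.2,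
  X.5 Cor. 5.4.
* [ShuZhai2021] J. Shu, S. Zhai, *Generalized Birch lemma and the 2-part of the Birch and Swinnerton-Dyer conjecture for
  certain elliptic curves*, arXiv:2102.11808, Def. 1.1, Thm. 1.2.
* [KlagsbrunMazurRubin2013] Z. Klagsbrun, B. Mazur, K. Rubin, *Disparity in Selmer ranks of quadratic twists of
  elliptic curves*, Ann. of Math. 178 (2013), Thm. 3.9.
-/

noncomputable section

open scoped Classical

namespace Summit.BirchSwinnertonDyer.BirchSwinnertonDyer.Theorems.GenusKolyvaginAtTwo.TorsionCellD0

open WeierstrassCurve WeierstrassCurve.Affine WeierstrassCurve.Affine.Point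
open Literature.NumberTheory.GaloisRepresentations Literature.NumberTheory.EllipticCurves Field
open Literature.NumberTheory.EllipticCurves.ShuZhai2021 (qStar IsInertInSqrt AllPrimesSplitInSqrt IsOptimalDatum
  CuspZeroNotInTwice)
open Literature.NumberTheory.EllipticCurves.ModularForms (ModularParametrizationData)
open IsDedekindDomain NumberField

variable (E₀ : WeierstrassCurve ℚ) [E₀.IsElliptic] [E₀.IsGloballyMinimal]

/-! ## A full-admissible prime at a full vertex is `≡ 3 (mod 4)` -/

section Admissible

/-- **A full-admissible prime of a globally minimal curve with two independent rational `2`-torsion points is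
`≡ 3 (mod 4)`**: the root differences are units at the good odd prime `q`; «`q` inert in `ℚ(√Δ(V))` for every
`2`-isogenous `V`» makes `δ₁, δ₂, δ₃` non-residues, hence `−1 ≡ δ₁δ₂δ₃ · □` is a non-residue at `q`.
[cite: ShuZhai2021, Def. 1.1] [cite: SilvermanAEC2009, Prop. X.1.4] -/
theorem emod_four_eq_three_of_fullAdmissible [inst : DecidableEq ℚ] {P Q : E₀.toAffine.Point}
    (hPQ : P ≠ Q) (hP0 : P ≠ 0) (hQ0 : Q ≠ 0) (hP2 : (2 : ℕ) • P = 0) (hQ2 : (2 : ℕ) • Q = 0)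
    {q : ℕ} (hqp : q.Prime) (hcop : Nat.Coprime q (2 * E₀.conductorNorm ℤ))
    (hinert : ∀ (V : WeierstrassCurve ℚ) [V.IsElliptic], (∃ φ : Isogeny E₀ V, φ.degree = 2) → IsInertInSqrt q V.Δ) :
    q % 4 = 3 := by
  have e : inst = fun a b => Classical.propDecidable (a = b) := Subsingleton.elim _ _
  subst e
  obtain ⟨a, b, c, hs⟩ := exists_splitTwoTorsion_of_two_torsion_points E₀ hPQ hP0 hQ0 hP2 hQ2
  haveI : Fact q.Prime := ⟨hqp⟩
  have hq1 : q ≠ 1 := hqp.ne_one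
  have hq2 : q ≠ 2 := by
    rintro rfl
    exact absurd (Nat.Coprime.eq_one_of_dvd hcop (dvd_mul_right 2 _)) hq1
  have hqN : ¬ q ∣ E₀.conductorNorm ℤ := fun hd =>
    hq1 (Nat.Coprime.eq_one_of_dvd hcop (Dvd.dvd.mul_left hd 2))
  obtain ⟨hv12, hv13, hv23⟩ := padicValRat_sub_roots_eq_zero_of_not_dvd_conductorNorm E₀ hs hq2 hqN
  obtain ⟨n₁, hn₁⟩ := exists_intCast_eq_four_mul_root E₀ hs
  obtain ⟨n₂, hn₂⟩ := exists_intCast_eq_four_mul_root E₀ hs.swap₁₂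
  obtain ⟨n₃, hn₃⟩ := exists_intCast_eq_four_mul_root E₀ hs.swap₂₃.swap₁₂
  obtain ⟨h₁, h₂, h₃⟩ := qrBit_delta_eq_one_of_forall_isogeny E₀ hs hq2 hn₁ hn₂ hn₃ hv12 hv13 hv23 hinert
  exact emod_four_eq_three_of_qrBit_delta E₀ hs hq2 h₁ h₂ h₃

end Admissible

/-! ## `q*` bookkeeping -/

section QStar

/-- `q* = −q` for `q ≡ 3 (mod 4)`. [cite: ShuZhai2021, §1] -/
theorem qStar_eq_neg_of_emod_four_eq_three {q : ℕ} (hq : q % 4 = 3) : qStar q = -(q : ℤ) := by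
  unfold qStar
  rw [if_neg (by omega)]

/-- For two primes `q₁ ≠ q₂`, both `≡ 3 (mod 4)`: `∏_{q ∈ {q₁, q₂}} q* = q₁q₂`. [cite: ShuZhai2021, §1] -/
theorem prod_qStar_pair_eq {q₁ q₂ : ℕ} (hne : q₁ ≠ q₂) (h₁ : q₁ % 4 = 3) (h₂ : q₂ % 4 = 3) :
    (∏ q ∈ ({q₁, q₂} : Finset ℕ), qStar q) = (q₁ : ℤ) * q₂ := by
  rw [Finset.prod_pair hne, qStar_eq_neg_of_emod_four_eq_three h₁, qStar_eq_neg_of_emod_four_eq_three h₂, neg_mul_neg]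

/-- For one prime `q ≡ 3 (mod 4)`: `∏_{q' ∈ {q}} q'* = −q` is NOT positive. [cite: ShuZhai2021, §1] -/
theorem not_prod_qStar_singleton_pos {q : ℕ} (h : q % 4 = 3) : ¬ 0 < ∏ q' ∈ ({q} : Finset ℕ), qStar q' := by
  rw [Finset.prod_singleton, qStar_eq_neg_of_emod_four_eq_three h]
  have : (0 : ℤ) ≤ q := Int.natCast_nonneg q
  omega

end QStar

/-! ## Transport to models: `#Sel⁽²⁾` and `#E(ℚ)[2]` are isomorphism invariants -/

section Transport

omit [E₀.IsGloballyMinimal] in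
/-- **`#Sel⁽²⁾` of any model `T • E₀^{(1)}` of the trivial twist is `#Sel⁽²⁾(E₀/ℚ)`** (`E₀^{(1)} ≅ E₀` by completing the
square; the Selmer group is attached to the curve, not to an equation). [cite: SilvermanAEC2009, Thm. X.4.2, X.5 Cor. 5.4] -/
theorem natCard_selmerGroup_smul_quadraticTwist_one (T : VariableChange ℚ) :
    Nat.card ((T • E₀.quadraticTwist 1).selmerGroup ((2 : ℕ) : ℤ)) = Nat.card (E₀.selmerGroup ((2 : ℕ) : ℤ)) := by
  haveI : (E₀.quadraticTwist 1).IsElliptic := E₀.isElliptic_quadraticTwist one_ne_zero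
  obtain ⟨C, hC⟩ := E₀.exists_variableChange_quadraticTwist_one
  rw [natCard_selmerGroup_smul (E₀.quadraticTwist 1) T two_ne_zero, ← hC, natCard_selmerGroup_smul E₀ C two_ne_zero]

omit [E₀.IsGloballyMinimal] in
/-- **`#Sel⁽²⁾` of any model `T • E₀^{(d)}` is `#Sel⁽²⁾(E₀^{(d)}/ℚ)`** (`d ≠ 0`). [cite: SilvermanAEC2009, Thm. X.4.2] -/
theorem natCard_selmerGroup_smul_quadraticTwist {d : ℚ} (hd : d ≠ 0) (T : VariableChange ℚ) :
    Nat.card ((T • E₀.quadraticTwist d).selmerGroup ((2 : ℕ) : ℤ)) =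
      Nat.card ((E₀.quadraticTwist d).selmerGroup ((2 : ℕ) : ℤ)) := by
  haveI : (E₀.quadraticTwist d).IsElliptic := E₀.isElliptic_quadraticTwist hd
  exact natCard_selmerGroup_smul (E₀.quadraticTwist d) T two_ne_zero

end Transport

/-! ## The one-step genus Selmer law -/

section Main

/-- **D0≤2 — the one-step genus Selmer law at a full vertex.**  `E₀/ℚ` globally minimal with two independent rational
`2`-torsion points, `rank E₀(ℚ) = 0`, `Ш(E₀)[2] = 0`; `p₀ ≡ 7 (mod 8)` prime with every `ℓ ∣ 2N₀` split in `ℚ(√−p₀)`;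
`Q₀` a finite set of full-admissible primes `≠ p₀` (`(q, 2N₀) = 1`, `q` inert in `ℚ(√Δ(V))` for every `2`-isogenous
`V`) with `#Q₀ ≤ 2`, `M₀ = ∏_{q ∈ Q₀} q* > 0` and every `ℓ ∣ 2N₀` split in `ℚ(√M₀)`.  Then for every model `C₀` of
`E₀^{(M₀)}` and every model `C₁` of `E₀^{(−p₀M₀)}`: `#C₀(ℚ)[2] = 4`, `#Sel⁽²⁾(C₀/ℚ) = 4`, `#C₁(ℚ)[2] = 4`,
`#Sel⁽²⁾(C₁/ℚ) = 8`.  (`#Q₀ = 1` cannot occur: full-admissible primes are `≡ 3 (mod 4)`, so `M₀ = −q < 0`.)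
[cite: ShuZhai2021, Def. 1.1, Thm. 1.2] [cite: SilvermanAEC2009, Prop. X.1.4, Thm. X.4.2]
[cite: KlagsbrunMazurRubin2013, Thm. 3.9] -/
theorem selmerGenericPair_of_fullTorsionBase [inst : DecidableEq ℚ] (hN : E₀.conductorNorm ℤ ≠ 0)
    {P Q : E₀.toAffine.Point} (hPQ : P ≠ Q) (hP0 : P ≠ 0) (hQ0 : Q ≠ 0) (hP2 : (2 : ℕ) • P = 0) (hQ2 : (2 : ℕ) • Q = 0)
    (hrank : E₀.mordellWeilRank = 0) (hsha : ∀ x ∈ E₀.sha, (2 : ℕ) • x = 0 → x = 0)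
    {p₀ : ℕ} (hp : p₀.Prime) (hp8 : p₀ % 8 = 7) (hsplitp : AllPrimesSplitInSqrt (2 * E₀.conductorNorm ℤ) (-(p₀ : ℤ)))
    {Q₀ : Finset ℕ}
    (hadm : ∀ q ∈ Q₀, (q.Prime ∧ Nat.Coprime q (2 * E₀.conductorNorm ℤ) ∧
      ∀ (V : WeierstrassCurve ℚ) [V.IsElliptic], (∃ φ : Isogeny E₀ V, φ.degree = 2) → IsInertInSqrt q V.Δ) ∧ q ≠ p₀)
    (hpos : 0 < ∏ q ∈ Q₀, qStar q) (hsplitM : AllPrimesSplitInSqrt (2 * E₀.conductorNorm ℤ) (∏ q ∈ Q₀, qStar q))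
    (hcard : Q₀.card ≤ 2) {C₀ C₁ : WeierstrassCurve ℚ}
    (hC₀ : ∃ T : VariableChange ℚ, T • E₀.quadraticTwist ((∏ q ∈ Q₀, qStar q : ℤ) : ℚ) = C₀)
    (hC₁ : ∃ T : VariableChange ℚ, T • E₀.quadraticTwist ((-(p₀ : ℤ) * ∏ q ∈ Q₀, qStar q : ℤ) : ℚ) = C₁) :
    (Nat.card (AddSubgroup.torsionBy C₀.toAffine.Point ((2 : ℕ) : ℤ)) = 4 ∧
        Nat.card (C₀.selmerGroup ((2 : ℕ) : ℤ)) = 4) ∧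
      (Nat.card (AddSubgroup.torsionBy C₁.toAffine.Point ((2 : ℕ) : ℤ)) = 4 ∧
        Nat.card (C₁.selmerGroup ((2 : ℕ) : ℤ)) = 8) := by
  have e : inst = fun a b => Classical.propDecidable (a = b) := Subsingleton.elim _ _
  subst e
  haveI : Fact p₀.Prime := ⟨hp⟩
  have hp0 : (p₀ : ℚ) ≠ 0 := by exact_mod_cast hp.ne_zero
  have h22 : ((2 : ℕ) : ℤ) = 2 := rfl
  -- the ordered split `2`-torsion of the base (for the torsion counts of the models)
  obtain ⟨a, b, c, habc⟩ := exists_splitTwoTorsion_of_two_torsion_points E₀ hPQ hP0 hQ0 hP2 hQ2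
  -- every `q ∈ Q₀` is `≡ 3 (mod 4)`
  have hmod : ∀ q ∈ Q₀, q % 4 = 3 := fun q hq =>
    emod_four_eq_three_of_fullAdmissible E₀ (inst := _) hPQ hP0 hQ0 hP2 hQ2 (hadm q hq).1.1 (hadm q hq).1.2.1
      (hadm q hq).1.2.2
  -- `#Q₀ ∈ {0, 2}`
  have hcases : Q₀.card = 0 ∨ Q₀.card = 2 := by
    have h1 : Q₀.card ≠ 1 := by
      intro h1
      obtain ⟨q, rfl⟩ := Finset.card_eq_one.mp h1
      exact not_prod_qStar_singleton_pos (hmod q (Finset.mem_singleton_self q)) hpos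
    omega
  rcases hcases with h0 | h2
  · -- `Q₀ = ∅`: `C₀ ≅ E₀^{(1)} ≅ E₀`, `C₁ ≅ E₀^{(−p₀)}`
    obtain rfl := Finset.card_eq_zero.mp h0
    rw [Finset.prod_empty, Int.cast_one] at hC₀
    rw [Finset.prod_empty, mul_one, Int.cast_neg, Int.cast_natCast] at hC₁
    obtain ⟨T₀, rfl⟩ := hC₀
    obtain ⟨T₁, rfl⟩ := hC₁
    haveI : (E₀.quadraticTwist (-(p₀ : ℚ))).IsElliptic := E₀.isElliptic_quadraticTwist (neg_ne_zero.mpr hp0)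
    refine ⟨⟨natCard_torsionBy_two_smul_quadraticTwist E₀ (inst := _) habc one_ne_zero T₀, ?_⟩,
      ⟨natCard_torsionBy_two_smul_quadraticTwist E₀ (inst := _) habc (neg_ne_zero.mpr hp0) T₁, ?_⟩⟩
    · rw [natCard_selmerGroup_smul_quadraticTwist_one, h22]
      exact E₀.natCard_selmerGroup_two_eq_four habc hrank hsha
    · rw [natCard_selmerGroup_smul_quadraticTwist E₀ (neg_ne_zero.mpr hp0), h22]
      exact natCard_selmerGroup_negPrime_twist_eq_eight_of_base E₀ (inst := _) hN hPQ hP0 hQ0 hP2 hQ2 hrank hsha hp8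
        hsplitp
  · -- `Q₀ = {q₁, q₂}`: `M₀ = q₁q₂`
    obtain ⟨q₁, q₂, hne, rfl⟩ := Finset.card_eq_two.mp h2
    have hq₁ := hadm q₁ (by simp)
    have hq₂ := hadm q₂ (by simp)
    haveI : Fact q₁.Prime := ⟨hq₁.1.1⟩
    haveI : Fact q₂.Prime := ⟨hq₂.1.1⟩
    have hprod : (∏ q ∈ ({q₁, q₂} : Finset ℕ), qStar q) = (q₁ : ℤ) * q₂ :=
      prod_qStar_pair_eq hne (hmod q₁ (by simp)) (hmod q₂ (by simp))
    rw [hprod] at hsplitM hC₀ hC₁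
    rw [Int.cast_mul, Int.cast_natCast, Int.cast_natCast] at hC₀
    rw [Int.cast_mul, Int.cast_neg, Int.cast_natCast, Int.cast_mul, Int.cast_natCast, Int.cast_natCast] at hC₁
    obtain ⟨T₀, rfl⟩ := hC₀
    obtain ⟨T₁, rfl⟩ := hC₁
    have hM0 : (q₁ : ℚ) * q₂ ≠ 0 := by exact_mod_cast mul_ne_zero hq₁.1.1.ne_zero hq₂.1.1.ne_zero
    have hM1 : -(p₀ : ℚ) * ((q₁ : ℚ) * q₂) ≠ 0 := mul_ne_zero (neg_ne_zero.mpr hp0) hM0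
    haveI : (E₀.quadraticTwist ((q₁ : ℚ) * q₂)).IsElliptic := E₀.isElliptic_quadraticTwist hM0
    haveI : (E₀.quadraticTwist (-(p₀ : ℚ) * ((q₁ : ℚ) * q₂))).IsElliptic := E₀.isElliptic_quadraticTwist hM1
    obtain ⟨h4, h8⟩ := natCard_selmerGroup_pair_twists_eq_of_base E₀ (inst := _) hN hPQ hP0 hQ0 hP2 hQ2 hrank hsha hp8
      hsplitp hne hq₁.2 hq₂.2 hq₁.1.2.1 hq₂.1.2.1 hq₁.1.2.2 hq₂.1.2.2 hsplitM
    refine ⟨⟨natCard_torsionBy_two_smul_quadraticTwist E₀ (inst := _) habc hM0 T₀, ?_⟩,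
      ⟨natCard_torsionBy_two_smul_quadraticTwist E₀ (inst := _) habc hM1 T₁, ?_⟩⟩
    · rw [natCard_selmerGroup_smul_quadraticTwist E₀ hM0, h22]
      exact h4
    · rw [natCard_selmerGroup_smul_quadraticTwist E₀ hM1, h22]
      exact h8

end Main

/-! ## LINE 49's D0≤2 with the line's definitions unfolded -/

section Unfolded

/-- **`FullTorsionGenusSelmerLawUpToTwoAtTwo`, unfolded.**  This is LINE 49's stub D0≤2 with its `def`s
`FullBaseSetting` / `HasFullRationalTwoTorsion` / `ShaTwoTrivial` / `IsFullAdmissible` / `IsGenusPair` /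
`IsSelmerGenericPair` replaced by their bodies verbatim (the optimal-datum conjuncts `IsOptimalDatum`, `2 ∤ c`,
`CuspZeroNotInTwice`, `3 < p₀` are carried but not used): in the hosted skeleton the stub is
`fun E₀ _ _ _ Dt p₀ Q₀ C₀ _ C₁ _ => fullTorsionGenusSelmerLawUpToTwoAtTwo_unfolded E₀ Dt p₀ Q₀ C₀ C₁`.
[cite: ShuZhai2021, Def. 1.1, Thm. 1.2] [cite: SilvermanAEC2009, Thm. X.4.2] [cite: KlagsbrunMazurRubin2013, Thm. 3.9] -/
theorem fullTorsionGenusSelmerLawUpToTwoAtTwo_unfolded [inst : DecidableEq ℚ]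
    (E₀ : WeierstrassCurve ℚ) [E₀.IsElliptic] [E₀.IsGloballyMinimal] [NeZero (E₀.conductorNorm ℤ)]
    (Dt : ModularParametrizationData E₀ (E₀.conductorNorm ℤ)) (p₀ : ℕ) (Q₀ : Finset ℕ)
    (C₀ : WeierstrassCurve ℚ) [C₀.IsElliptic] (C₁ : WeierstrassCurve ℚ) [C₁.IsElliptic] :
    ((∃ P Q : E₀.toAffine.Point, P ≠ Q ∧ P ≠ 0 ∧ Q ≠ 0 ∧ 2 • P = 0 ∧ 2 • Q = 0) ∧
      (∀ x ∈ E₀.sha, (2 : ℕ) • x = 0 → x = 0) ∧ IsOptimalDatum E₀ Dt ∧ ¬ (2 : ℤ) ∣ Dt.c ∧ CuspZeroNotInTwice E₀ Dt ∧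
      p₀.Prime ∧ 3 < p₀ ∧ p₀ % 8 = 7 ∧ AllPrimesSplitInSqrt (2 * E₀.conductorNorm ℤ) (-(p₀ : ℤ)) ∧
      (∀ q ∈ Q₀, (q.Prime ∧ Nat.Coprime q (2 * E₀.conductorNorm ℤ) ∧
        ∀ (V' : WeierstrassCurve ℚ) [V'.IsElliptic], (∃ φ : Isogeny E₀ V', φ.degree = 2) → IsInertInSqrt q V'.Δ) ∧
          q ≠ p₀) ∧
      0 < (∏ q ∈ Q₀, qStar q) ∧ AllPrimesSplitInSqrt (2 * E₀.conductorNorm ℤ) (∏ q ∈ Q₀, qStar q)) →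
    E₀.mordellWeilRank = 0 → Q₀.card ≤ 2 →
    ((∃ T : VariableChange ℚ, T • E₀.quadraticTwist ((∏ q ∈ Q₀, qStar q : ℤ) : ℚ) = C₀) ∧
      (∃ T : VariableChange ℚ, T • E₀.quadraticTwist ((-(p₀ : ℤ) * ∏ q ∈ Q₀, qStar q : ℤ) : ℚ) = C₁)) →
    (Nat.card (AddSubgroup.torsionBy C₀.toAffine.Point ((2 : ℕ) : ℤ)) = 4 ∧
        Nat.card (C₀.selmerGroup ((2 : ℕ) : ℤ)) = 4) ∧
      (Nat.card (AddSubgroup.torsionBy C₁.toAffine.Point ((2 : ℕ) : ℤ)) = 4 ∧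
        Nat.card (C₁.selmerGroup ((2 : ℕ) : ℤ)) = 8) := by
  rintro ⟨⟨P, Q, hPQ, hP0, hQ0, hP2, hQ2⟩, hsha, -, -, -, hp, -, hp8, hsplitp, hadm, hpos, hsplitM⟩ hrank hcard ⟨hC₀, hC₁⟩
  exact selmerGenericPair_of_fullTorsionBase E₀ (inst := _) (NeZero.ne _) hPQ hP0 hQ0 (by convert hP2) (by convert hQ2)
    hrank hsha hp hp8 hsplitp hadm hpos hsplitM hcard hC₀ hC₁

end Unfolded

end Summit.BirchSwinnertonDyer.BirchSwinnertonDyer.Theorems.GenusKolyvaginAtTwo.TorsionCellD0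

end
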